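import Literature.Barriers.QuantumFields.WilsonDeterminantSign
import Literature.MathematicalPhysics.QuantumLattice.GrassmannIntegralWilsonProofs

/-!
# Crux `MobilityGap` (stmt-QuantumFields-9150), line `Ideator6Sketch` (card `integer-pinch-unitary-point`) —
# the twisted Ward sum rule and the Hölder moment interpolation (helper file, `--supports` 9150)

Landed by the line lead (a1) from the round-2 ideator's first-lemma file `Cruxes/MobilityGap/Ideator6Sketch.lean`
(crux-ideate r2, ideator 6; proofs the ideator's, unchanged):

* `twistedWardSumRule` — for a `Γ`-Hermitian matrix `D` (`Γ D Γ = Dᴴ`, `Γ` a Hermitian involution) and a real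
  twist `ω ≠ 0`, with `A = D + iωΓ`:  `ω · Σ_q |A⁻¹(p,q)|² = -Im (A⁻¹ Γ)(p,p)` for every index `p` — the exact,
  configuration-wise lattice Ward identity "twisted mass × charged susceptibility = twisted condensate".
* `twistedWardSumRule_wilson` — its instance for the Wilson–Dirac operator of any `SU(3)` lattice gauge field on any
  four-torus (`Γ = Γ₅ = spinorLift gammaFive`, γ₅-hermiticity `wilsonDirac_gammaFive_hermitian_holds`).
* `moment_interpolation` — Hölder on a probability space: `∫X² ≤ (∫X^s)^{(q-2)/(q-s)} (∫X^q)^{(2-s)/(q-s)}` for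
  `0 < s < 2 < q`, `X ≥ 0` measurable with `X^q` integrable (the descent from a second-moment lower bound to an
  `s < 1` moment lower bound used by the line's stub S4).

Used by the line's skeleton (`Cruxes/MobilityGap/Lines/Ideator6Sketch.lean`): stub S3 (`stub_aokiLRO`) converts
long-range order of the twisted condensate into a second-moment lower bound through `twistedWardSumRule_wilson`, and
the closed step S4 descends to the core `LightMomentFree` through `moment_interpolation`.
-/

noncomputable section

open scoped BigOperators Topology ComplexConjugate
open MeasureTheory Filter Set Matrix Complex
open Literature.MathematicalPhysics.QuantumFieldTheory Literature.MathematicalPhysics.QuantumLattice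
  Literature.Probability.LatticeModels Literature.Barriers.QuantumFields.WilsonDeterminant

namespace Summit.QuantumFields.QCD.Theorems.MobilityGapPinch

/-- **Twisted Ward sum rule (abstract).** For a `Γ`-Hermitian matrix `D` (`Γ D Γ = Dᴴ`, `Γ` a
Hermitian involution) and a real twist `ω ≠ 0`, the twisted operator `A = D + iωΓ` is invertible and
for every index `p`: `ω · Σ_q |A⁻¹(p,q)|² = -Im (A⁻¹ Γ)(p,p)`.
Proof: `A` is injective (`Γ A = ΓD + iω` with `ΓD` Hermitian, so `Im⟨u, ΓA u⟩ = ω‖u‖²`),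
`X := A⁻¹`, `XΓ - ΓXᴴ = X(ΓAᴴ - AΓ)Xᴴ = (c̄ - c)·XXᴴ = -2iω·XXᴴ`, and the `(p,p)` entry's imaginary part
is the claim. -/
theorem twistedWardSumRule {n : Type*} [Fintype n] [DecidableEq n]
    (D Γ : Matrix n n ℂ) (hΓ : Γ.IsHermitian) (hΓ2 : Γ * Γ = 1) (hD : Γ * D * Γ = Dᴴ)
    (ω : ℝ) (hω : ω ≠ 0) (p : n) :
    ω * ∑ q, ‖(D + ((ω : ℂ) * Complex.I) • Γ)⁻¹ p q‖ ^ 2 =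
      -(((D + ((ω : ℂ) * Complex.I) • Γ)⁻¹ * Γ) p p).im := by
  set c : ℂ := (ω : ℂ) * Complex.I with hc
  set A : Matrix n n ℂ := D + c • Γ with hA
  have hΓh : Γᴴ = Γ := hΓ
  have hstarc : star c = -c := by
    rw [hc, star_mul', Complex.star_def, Complex.conj_ofReal, Complex.conj_I]
    ring
  -- `H = Γ D` is Hermitian
  have hH : (Γ * D).IsHermitian := by
    show (Γ * D)ᴴ = Γ * D
    rw [conjTranspose_mul, hΓh, ← hD, Matrix.mul_assoc, Matrix.mul_assoc, hΓ2, Matrix.mul_one]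
  -- `A` is injective, hence invertible
  have hinj : Function.Injective A.mulVec := by
    intro v w hvw
    have h0 : A *ᵥ (v - w) = 0 := by rw [mulVec_sub, hvw, sub_self]
    set u := v - w with hu
    -- apply Γ: (Γ D) u + c u = 0
    have h1 : (Γ * D) *ᵥ u + c • u = 0 := by
      have := congrArg (fun y => Γ *ᵥ y) h0
      simp only [mulVec_zero] at this
      rw [hA, add_mulVec, smul_mulVec, mulVec_add, mulVec_smul, mulVec_mulVec, mulVec_mulVec,
        hΓ2, one_mulVec] at this
      exact this
    -- pair with `star u`
    have h2 : star u ⬝ᵥ ((Γ * D) *ᵥ u) + c * (star u ⬝ᵥ u) = 0 := by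
      have := congrArg (fun y => star u ⬝ᵥ y) h1
      simp only [dotProduct_add, dotProduct_smul, smul_eq_mul, dotProduct_zero] at this
      exact this
    have hreal : (star u ⬝ᵥ ((Γ * D) *ᵥ u)).im = 0 := by
      simpa only [RCLike.im_to_complex] using hH.im_star_dotProduct_mulVec_self u
    have hnorm : star u ⬝ᵥ u = ((∑ i, ‖u i‖ ^ 2 : ℝ) : ℂ) := by
      rw [dotProduct, Complex.ofReal_sum]
      refine Finset.sum_congr rfl fun i _ => ?_
      rw [Pi.star_apply, Complex.star_def, ← Complex.normSq_eq_norm_sq, ← Complex.mul_conj, mul_comm]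
    set R : ℝ := ∑ i, ‖u i‖ ^ 2 with hR
    have him := congrArg Complex.im h2
    rw [Complex.add_im, hreal, zero_add, hnorm, Complex.zero_im, hc] at him
    have hωR : ω * R = 0 := by
      have e : ((ω : ℂ) * Complex.I * (R : ℂ)).im = ω * R := by
        simp [Complex.mul_im, Complex.mul_re]
      rw [e] at him
      exact him
    have hsum : R = 0 := by
      rcases mul_eq_zero.1 hωR with h | h
      · exact absurd h hω
      · exact h
    have hui : ∀ i, u i = 0 := by
      intro i
      have hle : ‖u i‖ ^ 2 ≤ ∑ j, ‖u j‖ ^ 2 :=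
        Finset.single_le_sum (f := fun j => ‖u j‖ ^ 2) (fun j _ => by positivity) (Finset.mem_univ i)
      rw [hR] at hsum
      rw [hsum] at hle
      have : ‖u i‖ ^ 2 = 0 := le_antisymm hle (by positivity)
      simpa using this
    have : u = 0 := funext hui
    exact sub_eq_zero.1 this
  have hunit : IsUnit A := (Matrix.mulVec_injective_iff_isUnit).1 hinj
  have hdet : IsUnit A.det := (Matrix.isUnit_iff_isUnit_det A).1 hunit
  set X : Matrix n n ℂ := A⁻¹ with hX
  have h1 : X * A = 1 := nonsing_inv_mul A hdet
  have h2 : Aᴴ * Xᴴ = 1 := by rw [← conjTranspose_mul, h1, conjTranspose_one]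
  have hAct : Aᴴ = Γ * D * Γ + (star c) • Γ := by
    rw [hA, conjTranspose_add, conjTranspose_smul, hΓh, hD]
  have hcomm : Γ * Aᴴ - A * Γ = (star c - c) • (1 : Matrix n n ℂ) := by
    rw [hAct, hA, Matrix.mul_add, Matrix.add_mul, Matrix.mul_smul, Matrix.smul_mul, ← Matrix.mul_assoc,
      ← Matrix.mul_assoc, hΓ2, Matrix.one_mul, sub_smul]
    abel
  have e1 : X * (Γ * Aᴴ) * Xᴴ = X * Γ := by
    rw [Matrix.mul_assoc, Matrix.mul_assoc, h2, Matrix.mul_one]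
  have e2 : X * (A * Γ) * Xᴴ = Γ * Xᴴ := by
    rw [← Matrix.mul_assoc, h1, Matrix.one_mul]
  have key : X * Γ - Γ * Xᴴ = (star c - c) • (X * Xᴴ) := by
    rw [← e1, ← e2, ← Matrix.sub_mul, ← Matrix.mul_sub, hcomm, Matrix.mul_smul, Matrix.mul_one,
      Matrix.smul_mul]
  -- the `(p,p)` entry
  have hpp := congrFun (congrFun key p) p
  have hΓX : (Γ * Xᴴ) p p = star ((X * Γ) p p) := by
    rw [← conjTranspose_apply, conjTranspose_mul, hΓh]
  have hXX : (X * Xᴴ) p p = ((∑ q, ‖X p q‖ ^ 2 : ℝ) : ℂ) := by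
    rw [Matrix.mul_apply, Complex.ofReal_sum]
    refine Finset.sum_congr rfl fun q _ => ?_
    rw [conjTranspose_apply, Complex.star_def, ← Complex.normSq_eq_norm_sq, ← Complex.mul_conj]
  rw [Matrix.sub_apply, Matrix.smul_apply, smul_eq_mul, hΓX, hXX, hstarc] at hpp
  -- imaginary parts
  have him := congrArg Complex.im hpp
  simp only [Complex.sub_im, Complex.star_def, Complex.conj_im, Complex.mul_im, Complex.ofReal_re,
    Complex.ofReal_im, mul_zero, add_zero, Complex.neg_re, Complex.neg_im, Complex.sub_re, hc,
    Complex.mul_re, Complex.I_re, Complex.I_im, Complex.ofReal_re, Complex.ofReal_im, mul_one,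
    sub_zero] at him
  -- `him : z.im - -z.im = (-(ω) - ω) * Σ‖X p q‖²`-ish; conclude
  show ω * ∑ q, ‖X p q‖ ^ 2 = -((X * Γ) p p).im
  nlinarith [him]

/-- **Twisted Ward sum rule, Wilson instance.** For every SU(3) lattice gauge field `U` on any
four-torus, every real bare mass `x` and twist `ω ≠ 0`, with `A = D_W(U,x,1) + iω Γ₅`
(`Γ₅ = spinorLift gammaFive`; γ₅-hermiticity is the discharged tree fact
`wilsonDirac_gammaFive_hermitian_holds`): for every quark index `p`,
`ω · Σ_q |A⁻¹(p,q)|² = -Im (A⁻¹Γ₅)(p,p)` — twisted mass × charged (row) susceptibility of the twisted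
quark propagator = local twisted condensate, configuration by configuration, on every volume, with any
boundary condition.  Averaged under ANY gauge-field measure it is the exact lattice form of the
Goldstone / Banks–Casher mechanism for the Aoki order parameter `⟨ψ̄ iγ₅ τ³ ψ⟩`. -/
theorem twistedWardSumRule_wilson :
    ∀ {L : ℕ} [NeZero L] (U : GaugeConfig 4 L (Matrix.specialUnitaryGroup (Fin 3) ℂ)) (x ω : ℝ), ω ≠ 0 →
      ∀ p : TorusSite 4 L × Fin 3 × Fin 4,
        ω * ∑ q, ‖(wilsonDirac (fundamentalRep (Fin 3)) U x 1 +
            ((ω : ℂ) * Complex.I) • (spinorLift gammaFive :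
              Matrix (TorusSite 4 L × Fin 3 × Fin 4) (TorusSite 4 L × Fin 3 × Fin 4) ℂ))⁻¹ p q‖ ^ 2 =
          -(((wilsonDirac (fundamentalRep (Fin 3)) U x 1 +
            ((ω : ℂ) * Complex.I) • (spinorLift gammaFive :
              Matrix (TorusSite 4 L × Fin 3 × Fin 4) (TorusSite 4 L × Fin 3 × Fin 4) ℂ))⁻¹ *
              (spinorLift gammaFive :
                Matrix (TorusSite 4 L × Fin 3 × Fin 4) (TorusSite 4 L × Fin 3 × Fin 4) ℂ)) p p).im := by
  intro L _ U x ω hω p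
  refine twistedWardSumRule _ _ ?_ spinorLift_gammaFive_mul_self ?_ ω hω p
  · -- `Γ₅` is Hermitian
    exact conjTranspose_spinorLift_gammaFive
  · exact wilsonDirac_gammaFive_hermitian_holds (fundamentalRep (Fin 3))
      fundamentalRep_mem_unitaryGroup U x 1

/-- **Moment interpolation (Hölder / Lyapunov).** On a probability space, for a non-negative measurable
`X` with `X^q` integrable and exponents `0 < s < 2 < q`:
`∫ X² ≤ (∫ X^s)^{(q-2)/(q-s)} · (∫ X^q)^{(2-s)/(q-s)}`. -/
theorem moment_interpolation {α : Type*} [MeasurableSpace α] {μ : Measure α} [IsProbabilityMeasure μ]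
    {X : α → ℝ} (hX : Measurable X) (hX0 : ∀ a, 0 ≤ X a) {s q : ℝ} (hs : 0 < s) (hs2 : s < 2)
    (hq : 2 < q) (hint : Integrable (fun a => X a ^ q) μ) :
    ∫ a, X a ^ (2 : ℝ) ∂μ ≤
      (∫ a, X a ^ s ∂μ) ^ ((q - 2) / (q - s)) * (∫ a, X a ^ q ∂μ) ^ ((2 - s) / (q - s)) := by
  -- exponents
  set θ : ℝ := (q - 2) / (q - s) with hθ
  have hqs : 0 < q - s := by linarith
  have hθ0 : 0 < θ := div_pos (by linarith) hqs
  have hθ1 : θ < 1 := by rw [hθ, div_lt_one hqs]; linarith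
  have h1θ : 0 < 1 - θ := by linarith
  have hθ' : 1 - θ = (2 - s) / (q - s) := by
    rw [hθ]; field_simp; ring
  -- Hölder conjugate exponents p = 1/θ, p' = 1/(1-θ)
  set p : ℝ := 1 / θ with hp
  set p' : ℝ := 1 / (1 - θ) with hp'
  have hp0 : 0 < p := by rw [hp]; positivity
  have hp'0 : 0 < p' := by rw [hp']; positivity
  have hpq : p.HolderConjugate p' := by
    refine ⟨?_, hp0, hp'0⟩
    rw [hp, hp', one_div, one_div, inv_inv, inv_inv, inv_one]
    ring
  -- the two factors
  set f : α → ℝ := fun a => X a ^ (θ * s) with hf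
  set g : α → ℝ := fun a => X a ^ ((1 - θ) * q) with hg
  have hf0 : ∀ a, 0 ≤ f a := fun a => Real.rpow_nonneg (hX0 a) _
  have hg0 : ∀ a, 0 ≤ g a := fun a => Real.rpow_nonneg (hX0 a) _
  have hfp : ∀ a, f a ^ p = X a ^ s := by
    intro a
    rw [hf, hp]
    simp only
    rw [← Real.rpow_mul (hX0 a)]
    congr 1
    field_simp
  have hgp : ∀ a, g a ^ p' = X a ^ q := by
    intro a
    rw [hg, hp']
    simp only
    rw [← Real.rpow_mul (hX0 a)]
    congr 1
    field_simp
  have hfg : ∀ a, f a * g a = X a ^ (2 : ℝ) := by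
    intro a
    rw [hf, hg]
    simp only
    rw [← Real.rpow_add' (hX0 a)]
    · congr 1
      rw [hθ]; field_simp; ring
    · have : θ * s + (1 - θ) * q = 2 := by rw [hθ]; field_simp; ring
      rw [this]; norm_num
  -- integrability of lower powers on a probability space: `X^t ≤ 1 + X^q` for `0 ≤ t ≤ q`
  have hdom : ∀ {t : ℝ}, 0 ≤ t → t ≤ q → Integrable (fun a => X a ^ t) μ := by
    intro t ht0 htq
    refine Integrable.mono' ((integrable_const (1 : ℝ)).add hint)
      ((hX.pow_const t).aestronglyMeasurable) (Eventually.of_forall fun a => ?_)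
    rw [Real.norm_eq_abs, abs_of_nonneg (Real.rpow_nonneg (hX0 a) _)]
    by_cases hx1 : X a ≤ 1
    · calc X a ^ t ≤ 1 := Real.rpow_le_one (hX0 a) hx1 ht0
        _ ≤ 1 + X a ^ q := le_add_of_nonneg_right (Real.rpow_nonneg (hX0 a) _)
    · push Not at hx1
      calc X a ^ t ≤ X a ^ q := Real.rpow_le_rpow_of_exponent_le hx1.le htq
        _ ≤ 1 + X a ^ q := le_add_of_nonneg_left zero_le_one
  -- MemLp of the factors
  have hθs0 : 0 ≤ θ * s := by positivity
  have hfmeas : AEStronglyMeasurable f μ := (hX.pow_const _).aestronglyMeasurable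
  have hgmeas : AEStronglyMeasurable g μ := (hX.pow_const _).aestronglyMeasurable
  have hfLp : MemLp f (ENNReal.ofReal p) μ := by
    rw [← integrable_norm_rpow_iff hfmeas (by simp [hp0]) ENNReal.ofReal_ne_top]
    rw [ENNReal.toReal_ofReal hp0.le]
    have : (fun a => ‖f a‖ ^ p) = fun a => X a ^ s := by
      funext a; rw [Real.norm_eq_abs, abs_of_nonneg (hf0 a), hfp a]
    rw [this]
    exact hdom hs.le (by linarith)
  have hgLp : MemLp g (ENNReal.ofReal p') μ := by
    rw [← integrable_norm_rpow_iff hgmeas (by simp [hp'0]) ENNReal.ofReal_ne_top]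
    rw [ENNReal.toReal_ofReal hp'0.le]
    have : (fun a => ‖g a‖ ^ p') = fun a => X a ^ q := by
      funext a; rw [Real.norm_eq_abs, abs_of_nonneg (hg0 a), hgp a]
    rw [this]
    exact hint
  have hH := integral_mul_le_Lp_mul_Lq_of_nonneg hpq (Eventually.of_forall hf0)
    (Eventually.of_forall hg0) hfLp hgLp
  -- rewrite Hölder's conclusion
  have e1 : (fun a => f a * g a) = fun a => X a ^ (2 : ℝ) := funext hfg
  have e2 : (fun a => f a ^ p) = fun a => X a ^ s := funext hfp
  have e3 : (fun a => g a ^ p') = fun a => X a ^ q := funext hgp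
  rw [show (∫ a, f a * g a ∂μ) = ∫ a, X a ^ (2 : ℝ) ∂μ from by rw [e1],
    show (∫ a, f a ^ p ∂μ) = ∫ a, X a ^ s ∂μ from by rw [e2],
    show (∫ a, g a ^ p' ∂μ) = ∫ a, X a ^ q ∂μ from by rw [e3]] at hH
  have hp1 : 1 / p = θ := by rw [hp, one_div_one_div]
  have hp'1 : 1 / p' = (2 - s) / (q - s) := by rw [hp', one_div_one_div, hθ']
  rw [hp1, hp'1] at hH
  exact hH

end Summit.QuantumFields.QCD.Theorems.MobilityGapPinch

end
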